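import Summits.RiemannHypothesis.RiemannHypothesis.Theorems.WeilFormatCCinfArchMonomials
import Summits.RiemannHypothesis.RiemannHypothesis.Theorems.WeilFormatCArchNodeSumExpansion
import Summits.RiemannHypothesis.RiemannHypothesis.Theorems.WeilFormatCPolyWindowEntryBox
import HarnessLib

/-!
# Format C, design C∞ (E2, data side): kernel boxes for the COLLECTED IMAGE COEFFICIENTS `P_img(q; t, d)` (ODD sector)

Route context: Fourier–Galerkin / Schur-complement certificates of Weil positivity on a window ("format C", C∞ door;
cell memo `run/shared/lean/pub/rh-explicit/rh-explicit-weil-2/gen15/E2-PLAN-v2.md` §5; supporting stmt-RiemannHypothesis-0098;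
seat rh-explicit-weil-2).  `abs_im_image_pow_sub_collected_le` (weil-10, KERNEL-LEVER §21) writes the far image
`Im W_a(1x^q, χ_m)` as `(2a)^{-1/2}(−1)^m[Σ_d P₁(q,d)/m^d + log m·Σ_d P_L/m^d − C_m·Σ_d P_C/m^d + S_m·Σ_d P_S/m^d] ± …`
with every `P` an explicit fiber sum of printed constants (odd twin of `WeilFormatCCinfImageCoeffBox`: polar factor
`(a/4π)qq^r` at odd powers with the constant `−8S_q s`, weights `α'_k = (a^{q−k} − (−a)^{q−k})Im(i^{k+1})`,
`β'_k = −(a^{q−k} + (−a)^{q−k})Re(i^{k+1})`, bracket part `Im(i^{k+1}K_{q,k})`).  This file evaluates those fiber sums in fixed-point interval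
arithmetic from INPUT boxes (`ImgInputsO`): `P ∋ π`, `AP ∋ a/π`, `A2P ∋ a/(2π)`, `QQ ∋ a²/(4π²)`,
`Pol ∋ −8S_q(e^{a/2} − e^{−a/2})` (polar constant, `WinPole.sinhMomBox`/`expHalfBoxes`), `Kc ∋ κ_c = ½log(π/2a) − ½ψ(¼) − D_{−1}`,
the window brackets `KRe[k] ∋ Im(i^{k+1}·K_{q,k})` (`k ≤ q`; gen8 `WinMixed` prime/arch brackets, `tailBox`, `markovBox`),
a Bernoulli list and node-moment boxes — and proves membership for the VERBATIM (beta-reduced) fiber sums: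
`mem_imgPureBoxO`, `mem_imgLogBoxO`, `mem_imgCosBoxO`, `mem_imgSinBoxO` (all generic pieces carry the suffix `O` so that both sector files can be imported together).  Interval plumbing only; standard axioms; no RH claim.
-/

set_option autoImplicit false
-- `Summit.RiemannHypothesis.RiemannHypothesis.…` is the layout-mandated namespace (summit = problem name).
set_option linter.dupNamespace false

open Finset Complex MeasureTheory Set
open scoped Real ArithmeticFunction.vonMangoldt

namespace Summit.RiemannHypothesis.RiemannHypothesis.Theorems.WeilFormatC

open Literature.NumberTheory.LFunctions Literature.NumberTheory.LFunctions.Yoshida1992 Literature.Analysis.SpecialFunctions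
open Literature.Analysis.ValidatedNumerics Literature.Analysis.ValidatedNumerics.NumericsMP

namespace CinfCoeff

open WinConst (ratBox mem_ratBox mulRatBox mem_mulRatBox)
open WinEntry (sumBox mem_sumBox)

variable {S : ℕ}

/-! ## Generic pieces (image-side copies, distinct names from the row file) -/

/-- `x^n` by repeated outward multiplication. -/
def powIO (S : ℕ) (X : MI) : ℕ → MI
  | 0 => MI.ofInt S 1
  | n + 1 => (powIO S X n).mul S X

/-- `powIO ∋ x^n`. -/
theorem mem_powIO (hS : 0 < S) {x : ℝ} {X : MI} (hx : MI.mem S x X) : ∀ n : ℕ, MI.mem S (x ^ n) (powIO S X n)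
  | 0 => by simpa [powIO] using MI.mem_ofInt S 1
  | n + 1 => by rw [pow_succ, powIO]; exact MI.mem_mul hS (mem_powIO hS hx n) hx

/-- Filtered range sum `Σ_{k<n, p k} F k`. -/
def sumFIO (S : ℕ) (n : ℕ) (p : ℕ → Prop) [DecidablePred p] (F : ℕ → MI) : MI :=
  sumBox S (fun k ↦ if p k then F k else MI.ofInt S 0) n

/-- `sumFIO ∋ Σ_{k ∈ (range n).filter p} g k`. -/
theorem mem_sumFIO {n : ℕ} {p : ℕ → Prop} [DecidablePred p] {g : ℕ → ℝ} {F : ℕ → MI}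
    (h : ∀ k, k < n → p k → MI.mem S (g k) (F k)) :
    MI.mem S (∑ k ∈ (Finset.range n).filter p, g k) (sumFIO S n p F) := by
  rw [Finset.sum_filter, sumFIO]
  refine mem_sumBox n fun k hk ↦ ?_
  by_cases hp : p k
  · rw [if_pos hp, if_pos hp]; exact h k hk hp
  · rw [if_neg hp, if_neg hp]; simpa using MI.mem_ofInt S 0

/-- Filtered double sum over `[0,n) × [1,K]`. -/
def sumKNO (S : ℕ) (n K : ℕ) (p : ℕ × ℕ → Prop) [DecidablePred p] (F : ℕ → ℕ → MI) : MI :=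
  sumBox S (fun k ↦ sumBox S (fun j ↦ if p (k, j + 1) then F k (j + 1) else MI.ofInt S 0) K) n

/-- `sumKNO ∋ Σ_{x ∈ (range n ×ˢ Icc 1 K).filter p} g x`. -/
theorem mem_sumKNO {n K : ℕ} {p : ℕ × ℕ → Prop} [DecidablePred p] {g : ℕ × ℕ → ℝ} {F : ℕ → ℕ → MI}
    (h : ∀ k N, k < n → 1 ≤ N → N ≤ K → p (k, N) → MI.mem S (g (k, N)) (F k N)) :
    MI.mem S (∑ x ∈ (Finset.range n ×ˢ Finset.Icc 1 K).filter p, g x) (sumKNO S n K p F) := by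
  rw [Finset.sum_filter, Finset.sum_product, sumKNO]
  refine mem_sumBox n fun k hk ↦ ?_
  have hIcc : ∑ N ∈ Finset.Icc 1 K, (if p (k, N) then g (k, N) else 0)
      = ∑ j ∈ Finset.range K, (if p (k, j + 1) then g (k, j + 1) else 0) := by
    rw [← Finset.Ico_succ_right_eq_Icc, Order.succ_eq_add_one, Finset.sum_Ico_eq_sum_range,
      show K + 1 - 1 = K by omega]
    simp only [add_comm 1]
  rw [hIcc]
  refine mem_sumBox K fun j hj ↦ ?_
  by_cases hp : p (k, j + 1)
  · rw [if_pos hp, if_pos hp]; exact h k (j + 1) hk (by omega) (by omega) hp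
  · rw [if_neg hp, if_neg hp]; simpa using MI.mem_ofInt S 0

/-- Filtered double sum over `[0,n) × [0,R)`. -/
def sumKRO (S : ℕ) (n R : ℕ) (p : ℕ × ℕ → Prop) [DecidablePred p] (F : ℕ → ℕ → MI) : MI :=
  sumBox S (fun k ↦ sumBox S (fun r ↦ if p (k, r) then F k r else MI.ofInt S 0) R) n

/-- `sumKRO ∋ Σ_{x ∈ (range n ×ˢ range R).filter p} g x`. -/
theorem mem_sumKRO {n R : ℕ} {p : ℕ × ℕ → Prop} [DecidablePred p] {g : ℕ × ℕ → ℝ} {F : ℕ → ℕ → MI}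
    (h : ∀ k r, k < n → r < R → p (k, r) → MI.mem S (g (k, r)) (F k r)) :
    MI.mem S (∑ x ∈ (Finset.range n ×ˢ Finset.range R).filter p, g x) (sumKRO S n R p F) := by
  rw [Finset.sum_filter, Finset.sum_product, sumKRO]
  refine mem_sumBox n fun k hk ↦ mem_sumBox R fun r hr ↦ ?_
  by_cases hp : p (k, r)
  · rw [if_pos hp, if_pos hp]; exact h k r hk hr hp
  · rw [if_neg hp, if_neg hp]; simpa using MI.mem_ofInt S 0

/-- `Re(i^n)` as a rational. -/
def reIQO (n : ℕ) : ℚ := if n % 4 = 0 then 1 else if n % 4 = 2 then -1 else 0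

/-- `Im(i^n)` as a rational. -/
def imIQO (n : ℕ) : ℚ := if n % 4 = 1 then 1 else if n % 4 = 3 then -1 else 0

/-- `Re(i^n) = reIQO n`. -/
theorem reIQ_castO (n : ℕ) : (I ^ n).re = ((reIQO n : ℚ) : ℝ) := by
  rw [I_pow_eq_I_pow_mod_four n, reIQO]
  have h4 : n % 4 < 4 := Nat.mod_lt _ (by norm_num)
  interval_cases hn : n % 4 <;> simp [pow_succ]

/-- `Im(i^n) = imIQO n`. -/
theorem imIQ_castO (n : ℕ) : (I ^ n).im = ((imIQO n : ℚ) : ℝ) := by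
  rw [I_pow_eq_I_pow_mod_four n, imIQO]
  have h4 : n % 4 < 4 := Nat.mod_lt _ (by norm_num)
  interval_cases hn : n % 4 <;> simp [pow_succ]

/-- `b_N` from a Bernoulli list (image-side copy). -/
def bNQO (bt : List ℚ) (ν N : ℕ) : ℚ :=
  1 - 1 / (2 * (N : ℚ)) - (∑ l ∈ Finset.Icc 1 ν, bt.getD (l - 1) 0 / (2 * l) * 16 ^ l * (((N - 1).choose (2 * l - 1) : ℕ) : ℚ)) / 2

/-- Cast of `bNQO`. -/
theorem bNQ_castO (bt : List ℚ) {ν : ℕ} (hbt : ∀ k, k < ν → bt.getD k 0 = bernoulli (2 * (k + 1))) (N : ℕ) :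
    ((bNQO bt ν N : ℚ) : ℝ) = 1 - 1 / (2 * (N : ℝ))
      - (∑ l ∈ Finset.Icc 1 ν, (bernoulli (2 * l) : ℝ) / (2 * l) * 16 ^ l * (((N - 1).choose (2 * l - 1) : ℕ) : ℝ)) / 2 := by
  rw [bNQO]; push_cast
  congr 2
  refine Finset.sum_congr rfl fun l hl ↦ ?_
  rw [Finset.mem_Icc] at hl
  have h := hbt (l - 1) (by omega)
  rw [show l - 1 + 1 = l by omega] at h
  rw [h]

/-- `c_N = (1, 0, −1, 0)` by `N mod 4` (cosine pattern). -/
def cosQO (N : ℕ) : ℚ := if N % 4 = 0 then 1 else if N % 4 = 2 then -1 else 0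

/-- `σ_N = (0, 1, 0, −1)` by `N mod 4` (sine pattern). -/
def sinQO (N : ℕ) : ℚ := if N % 4 = 1 then 1 else if N % 4 = 3 then -1 else 0

/-- Cast of `cosQO`. -/
theorem cosQ_castO (N : ℕ) : ((cosQO N : ℚ) : ℝ) = (if N % 4 = 0 then (1 : ℝ) else if N % 4 = 2 then -1 else 0) := by
  unfold cosQO; split_ifs <;> simp

/-- Cast of `sinQO`. -/
theorem sinQ_castO (N : ℕ) : ((sinQO N : ℚ) : ℝ) = (if N % 4 = 1 then (1 : ℝ) else if N % 4 = 3 then -1 else 0) := by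
  unfold sinQO; split_ifs <;> simp

/-! ## Inputs -/

/-- Input boxes for the images of the window power `x^q`. -/
structure ImgInputsO where
  /-- `∋ π` -/
  P : MI
  /-- `∋ a/π` -/
  AP : MI
  /-- `∋ a/(2π)` -/
  A2P : MI
  /-- `∋ a²/(4π²)` -/
  QQ : MI
  /-- `∋ −8 S_q (e^{a/2} − e^{−a/2})`, `S_q = ∫_{−a}^{a} x^q sinh(x/2)` -/
  Pol : MI
  /-- `∋ κ_c = ½log(π/2a) − ½Re ψ(¼) − D_{−1}` -/
  Kc : MI
  /-- `KRe[k] ∋ Im(i^{k+1} K_{q,k})`, the window bracket, `k ≤ q` -/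
  KRe : List MI
  /-- Bernoulli list, `bt[l−1] = B_{2l}` -/
  bt : List ℚ
  /-- node-moment boxes, `Dl[s] ∋ D_s(a)` -/
  Dl : List MI

/-- The complex window bracket `K_{q,k}` of `abs_re_image_pow_sub_monomials_le` (verbatim). -/
noncomputable def KbracketO (a : ℝ) (q k : ℕ) : ℂ :=
  (∑ n ∈ weilPrimeIndex a, ((Λ n : ℝ) / Real.sqrt n : ℂ) *
      (((a : ℂ)) ^ (q - k) - (((-a : ℝ)) : ℂ) ^ (q - k)
        + (((a : ℂ)) ^ (q - k) - (((a - Real.log n : ℝ)) : ℂ) ^ (q - k))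
        + ((((-a + Real.log n : ℝ)) : ℂ) ^ (q - k) - (((-a : ℝ)) : ℂ) ^ (q - k))))
    + ((∫ t in Ioc 0 (2 * a), weilArchDensity t *
        ((a ^ (q - k) - (a - t) ^ (q - k)) + ((-a + t) ^ (q - k) - (-a) ^ (q - k))) : ℝ) : ℂ)
    + (2 * ((∫ t in Ioi (2 * a), weilArchDensity t : ℝ) : ℂ) - (weilMarkovConstant a : ℂ))
        * (((a : ℂ)) ^ (q - k) - (((-a : ℝ)) : ℂ) ^ (q - k))

/-- Validity of the image inputs for window `a`, power `q`, Stirling order `ν`, polar order `R`. -/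
structure ImgInputsValidO (S : ℕ) (a : ℚ) (q ν R : ℕ) (X : ImgInputsO) : Prop where
  hP : MI.mem S Real.pi X.P
  hAP : MI.mem S ((a : ℝ) / Real.pi) X.AP
  hA2P : MI.mem S ((a : ℝ) / (2 * Real.pi)) X.A2P
  hQQ : MI.mem S ((a : ℝ) ^ 2 / (4 * Real.pi ^ 2)) X.QQ
  hPol : MI.mem S (-(8 * (∫ x in (-(a : ℝ))..(a : ℝ), x ^ q * Real.sinh (x / 2))
            * (Real.exp ((a : ℝ) / 2) - Real.exp (-((a : ℝ) / 2))))) X.Pol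
  hKc : MI.mem S (Real.log (π / (2 * (a : ℝ))) / 2 - reDigammaQuarter 0 / 2
            - ∑' l : ℕ, Real.exp (-(2 * (a : ℝ) * digammaNode l)) / digammaNode l) X.Kc
  hKRe : ∀ k, k ≤ q → MI.mem S ((I ^ (k + 1) * KbracketO (a : ℝ) q k).im) (X.KRe.getD k default)
  hbt : ∀ k, k < ν → X.bt.getD k 0 = bernoulli (2 * (k + 1))
  hD : ∀ s, s ≤ 2 * R + 1 →
    MI.mem S (∑' k : ℕ, Real.exp (-(2 * (a : ℝ) * digammaNode k)) * digammaNode k ^ s) (X.Dl.getD s default)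

/-! ## The four tag boxes -/

section Boxes

variable {a : ℚ} {q ν R : ℕ} {X : ImgInputsO}

/-- `w_k = (−1)^k q^{(k)}` (rational). -/
def wQO (q k : ℕ) : ℚ := (-1) ^ k * (q.descFactorial k : ℚ)

/-- `α'_k = (a^{q−k} − (−a)^{q−k}) Im(i^{k+1})` (rational). -/
def alphaQO (a : ℚ) (q k : ℕ) : ℚ := (a ^ (q - k) - (-a) ^ (q - k)) * imIQO (k + 1)

/-- `β'_k = −(a^{q−k} + (−a)^{q−k}) Re(i^{k+1})` (rational). -/
def betaQO (a : ℚ) (q k : ℕ) : ℚ := -((a ^ (q - k) + (-a) ^ (q - k)) * reIQO (k + 1))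

/-- Cast of `wQO`. -/
theorem wQ_castO (q k : ℕ) : ((wQO q k : ℚ) : ℝ) = (-1 : ℝ) ^ k * (q.descFactorial k : ℝ) := by
  unfold wQO; push_cast; ring

/-- Cast of `alphaQO`. -/
theorem alphaQ_castO (a : ℚ) (q k : ℕ) :
    ((alphaQO a q k : ℚ) : ℝ) = ((a : ℝ) ^ (q - k) - (-(a : ℝ)) ^ (q - k)) * (I ^ (k + 1)).im := by
  unfold alphaQO; rw [imIQ_castO]; push_cast; ring

/-- Cast of `betaQO`. -/
theorem betaQ_castO (a : ℚ) (q k : ℕ) :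
    ((betaQO a q k : ℚ) : ℝ) = -(((a : ℝ) ^ (q - k) + (-(a : ℝ)) ^ (q - k)) * (I ^ (k + 1)).re) := by
  unfold betaQO; rw [reIQ_castO]; push_cast; ring

/-- **Pure-tag image coefficient box** `P₁(q, dd)`. -/
def imgPureBoxO (S : ℕ) (X : ImgInputsO) (a : ℚ) (q ν K R J dd : ℕ) : MI :=
  (((((sumFIO S J (fun r ↦ 2 * r + 1 = dd) (fun r ↦ mulRatBox ((X.Pol.mul S (X.A2P.divNat 2)).mul S (powIO S X.QQ r)) ((-1 : ℚ) ^ r))).add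
    (sumFIO S (q + 1) (fun k ↦ k + 1 = dd)
      (fun k ↦ (powIO S X.AP (k + 1)).mul S
        (((mulRatBox (X.KRe.getD k default) (wQO q k)).add (mulRatBox X.Kc (wQO q k * alphaQO a q k))).add
          (mulRatBox (X.P.divNat 4) (wQO q k * betaQO a q k)))))).add
    (sumKNO S (q + 1) K (fun x ↦ x.1 + 1 + x.2 = dd)
      (fun k N ↦ mulRatBox ((powIO S X.AP (k + 1)).mul S (powIO S X.A2P N)) (wQO q k * alphaQO a q k * cosQO N * bNQO X.bt ν N)))).add
    (sumKRO S (q + 1) R (fun x ↦ x.1 + 1 + (2 * x.2 + 2) = dd)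
      (fun k r ↦ mulRatBox (((powIO S X.AP (k + 1)).mul S (X.Dl.getD (2 * r + 1) default)).mul S (powIO S X.AP (2 * r + 2)))
        (wQO q k * alphaQO a q k * (-1 : ℚ) ^ r)))).add
    (sumKNO S (q + 1) K (fun x ↦ x.1 + 1 + x.2 = dd)
      (fun k N ↦ mulRatBox ((powIO S X.AP (k + 1)).mul S (powIO S X.A2P N)) (wQO q k * betaQO a q k * sinQO N * bNQO X.bt ν N)))).sub
    (sumKRO S (q + 1) R (fun x ↦ x.1 + 1 + (2 * x.2 + 1) = dd)
      (fun k r ↦ mulRatBox (((powIO S X.AP (k + 1)).mul S (X.Dl.getD (2 * r) default)).mul S (powIO S X.AP (2 * r + 1)))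
        (wQO q k * betaQO a q k * (-1 : ℚ) ^ r)))

/-- **`imgPureBoxO ∋ P₁(q,dd)`**, the `dd`-th pure-tag fiber sum of `abs_re_image_pow_sub_collected_le` (beta-reduced, with
`K_{q,k} = KbracketO a q k`). -/
theorem mem_imgPureBoxO (hS : 0 < S) (hX : ImgInputsValidO S a q ν R X) (K J dd : ℕ) :
    MI.mem S
      ((∑ r ∈ (Finset.range J).filter (fun r ↦ 2 * r + 1 = dd),
          (-(8 * (∫ x in (-(a : ℝ))..(a : ℝ), x ^ q * Real.sinh (x / 2)) * (Real.exp ((a : ℝ) / 2) - Real.exp (-((a : ℝ) / 2)))))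
            * ((-1 : ℝ) ^ r * ((a : ℝ) / (4 * π)) * ((a : ℝ) ^ 2 / (4 * π ^ 2)) ^ r))
        + (∑ k ∈ (Finset.range (q + 1)).filter (fun k ↦ k + 1 = dd),
            (((-1 : ℝ) ^ k * (q.descFactorial k : ℝ) * ((a : ℝ) / π) ^ (k + 1)) * (I ^ (k + 1) * KbracketO (a : ℝ) q k).im
            + ((-1 : ℝ) ^ k * (q.descFactorial k : ℝ) * ((a : ℝ) / π) ^ (k + 1))
              * (((a : ℝ) ^ (q - k) - (-(a : ℝ)) ^ (q - k)) * (I ^ (k + 1)).im)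
              * (Real.log (π / (2 * (a : ℝ))) / 2 - reDigammaQuarter 0 / 2
                  - ∑' l : ℕ, Real.exp (-(2 * (a : ℝ) * digammaNode l)) / digammaNode l)
            + ((-1 : ℝ) ^ k * (q.descFactorial k : ℝ) * ((a : ℝ) / π) ^ (k + 1))
              * (-(((a : ℝ) ^ (q - k) + (-(a : ℝ)) ^ (q - k)) * (I ^ (k + 1)).re)) * (π / 4)))
        + (∑ x ∈ (Finset.range (q + 1) ×ˢ Finset.Icc 1 K).filter (fun x ↦ x.1 + 1 + x.2 = dd),
            ((-1 : ℝ) ^ x.1 * (q.descFactorial x.1 : ℝ) * ((a : ℝ) / π) ^ (x.1 + 1))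
              * (((a : ℝ) ^ (q - x.1) - (-(a : ℝ)) ^ (q - x.1)) * (I ^ (x.1 + 1)).im)
              * ((if x.2 % 4 = 0 then (1 : ℝ) else if x.2 % 4 = 2 then -1 else 0)
                  * (1 - 1 / (2 * (x.2 : ℝ))
                      - (∑ l ∈ Finset.Icc 1 ν, (bernoulli (2 * l) : ℝ) / (2 * l) * 16 ^ l
                          * (((x.2 - 1).choose (2 * l - 1) : ℕ) : ℝ)) / 2)
                  * ((a : ℝ) / (2 * π)) ^ x.2))
        + (∑ x ∈ (Finset.range (q + 1) ×ˢ Finset.range R).filter (fun x ↦ x.1 + 1 + (2 * x.2 + 2) = dd),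
            ((-1 : ℝ) ^ x.1 * (q.descFactorial x.1 : ℝ) * ((a : ℝ) / π) ^ (x.1 + 1))
              * (((a : ℝ) ^ (q - x.1) - (-(a : ℝ)) ^ (q - x.1)) * (I ^ (x.1 + 1)).im)
              * ((-1 : ℝ) ^ x.2 * (∑' l : ℕ, Real.exp (-(2 * (a : ℝ) * digammaNode l)) * digammaNode l ^ (2 * x.2 + 1))
                  * ((a : ℝ) / π) ^ (2 * x.2 + 2)))
        + (∑ x ∈ (Finset.range (q + 1) ×ˢ Finset.Icc 1 K).filter (fun x ↦ x.1 + 1 + x.2 = dd),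
            ((-1 : ℝ) ^ x.1 * (q.descFactorial x.1 : ℝ) * ((a : ℝ) / π) ^ (x.1 + 1))
              * (-(((a : ℝ) ^ (q - x.1) + (-(a : ℝ)) ^ (q - x.1)) * (I ^ (x.1 + 1)).re))
              * ((if x.2 % 4 = 1 then (1 : ℝ) else if x.2 % 4 = 3 then -1 else 0)
                  * (1 - 1 / (2 * (x.2 : ℝ))
                      - (∑ l ∈ Finset.Icc 1 ν, (bernoulli (2 * l) : ℝ) / (2 * l) * 16 ^ l
                          * (((x.2 - 1).choose (2 * l - 1) : ℕ) : ℝ)) / 2)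
                  * ((a : ℝ) / (2 * π)) ^ x.2))
        - (∑ x ∈ (Finset.range (q + 1) ×ˢ Finset.range R).filter (fun x ↦ x.1 + 1 + (2 * x.2 + 1) = dd),
            ((-1 : ℝ) ^ x.1 * (q.descFactorial x.1 : ℝ) * ((a : ℝ) / π) ^ (x.1 + 1))
              * (-(((a : ℝ) ^ (q - x.1) + (-(a : ℝ)) ^ (q - x.1)) * (I ^ (x.1 + 1)).re))
              * ((-1 : ℝ) ^ x.2 * (∑' l : ℕ, Real.exp (-(2 * (a : ℝ) * digammaNode l)) * digammaNode l ^ (2 * x.2))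
                  * ((a : ℝ) / π) ^ (2 * x.2 + 1))))
      (imgPureBoxO S X a q ν K R J dd) := by
  have hπ : Real.pi ≠ 0 := Real.pi_ne_zero
  set κ : ℝ := Real.log (π / (2 * (a : ℝ))) / 2 - reDigammaQuarter 0 / 2
      - ∑' l : ℕ, Real.exp (-(2 * (a : ℝ) * digammaNode l)) / digammaNode l with hκ
  unfold imgPureBoxO
  refine MI.mem_sub (MI.mem_add (MI.mem_add (MI.mem_add (MI.mem_add ?_ ?_) ?_) ?_) ?_) ?_
  · -- polar
    refine mem_sumFIO fun r _ _ ↦ ?_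
    have hA4 : MI.mem S ((a : ℝ) / (4 * Real.pi)) (X.A2P.divNat 2) := by
      have := MI.mem_divNat hX.hA2P (n := 2) (by norm_num); convert this using 1; ring
    have hm := mem_mulRatBox (MI.mem_mul hS (MI.mem_mul hS hX.hPol hA4) (mem_powIO hS hX.hQQ r)) ((-1 : ℚ) ^ r)
    convert hm using 1
    push_cast; ring
  · -- k-bracket
    refine mem_sumFIO fun k hk _ ↦ ?_
    have hK := hX.hKRe k (by omega)
    have h1 := mem_mulRatBox hK (wQO q k)
    have h2 := mem_mulRatBox hX.hKc (wQO q k * alphaQO a q k)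
    have h3 := mem_mulRatBox (MI.mem_divNat hX.hP (n := 4) (by norm_num)) (wQO q k * betaQO a q k)
    have hm := MI.mem_mul hS (mem_powIO hS hX.hAP (k + 1)) (MI.mem_add (MI.mem_add h1 h2) h3)
    convert hm using 1
    push_cast
    rw [wQ_castO, alphaQ_castO, betaQ_castO]
    ring
  · -- α × cosine Stirling
    refine mem_sumKNO fun k N _ _ _ _ ↦ ?_
    have hm := mem_mulRatBox (MI.mem_mul hS (mem_powIO hS hX.hAP (k + 1)) (mem_powIO hS hX.hA2P N))
      (wQO q k * alphaQO a q k * cosQO N * bNQO X.bt ν N)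
    convert hm using 1
    push_cast
    rw [wQ_castO, alphaQ_castO, cosQ_castO, bNQ_castO X.bt hX.hbt]
    ring
  · -- α × odd node moments
    refine mem_sumKRO fun k r _ hr _ ↦ ?_
    have hDm := hX.hD (2 * r + 1) (by omega)
    have hm := mem_mulRatBox (MI.mem_mul hS (MI.mem_mul hS (mem_powIO hS hX.hAP (k + 1)) hDm)
      (mem_powIO hS hX.hAP (2 * r + 2))) (wQO q k * alphaQO a q k * (-1 : ℚ) ^ r)
    convert hm using 1
    push_cast
    rw [wQ_castO, alphaQ_castO]
    ring
  · -- β × sine Stirling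
    refine mem_sumKNO fun k N _ _ _ _ ↦ ?_
    have hm := mem_mulRatBox (MI.mem_mul hS (mem_powIO hS hX.hAP (k + 1)) (mem_powIO hS hX.hA2P N))
      (wQO q k * betaQO a q k * sinQO N * bNQO X.bt ν N)
    convert hm using 1
    push_cast
    rw [wQ_castO, betaQ_castO, sinQ_castO, bNQ_castO X.bt hX.hbt]
    ring
  · -- β × even node moments
    refine mem_sumKRO fun k r _ hr _ ↦ ?_
    have hDm := hX.hD (2 * r) (by omega)
    have hm := mem_mulRatBox (MI.mem_mul hS (MI.mem_mul hS (mem_powIO hS hX.hAP (k + 1)) hDm)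
      (mem_powIO hS hX.hAP (2 * r + 1))) (wQO q k * betaQO a q k * (-1 : ℚ) ^ r)
    convert hm using 1
    push_cast
    rw [wQ_castO, betaQ_castO]
    ring

/-- **Log-tag image coefficient box**: `Σ_{k+1=dd} w_k (a/π)^{k+1} α_k / 2`. -/
def imgLogBoxO (S : ℕ) (X : ImgInputsO) (a : ℚ) (q dd : ℕ) : MI :=
  sumFIO S (q + 1) (fun k ↦ k + 1 = dd) (fun k ↦ mulRatBox (powIO S X.AP (k + 1)) (wQO q k * alphaQO a q k / 2))

/-- **`imgLogBoxO ∋ P_L(q,dd)`** (verbatim, beta-reduced). -/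
theorem mem_imgLogBoxO (hS : 0 < S) (hX : ImgInputsValidO S a q ν R X) (dd : ℕ) :
    MI.mem S (∑ k ∈ (Finset.range (q + 1)).filter (fun k ↦ k + 1 = dd),
        ((-1 : ℝ) ^ k * (q.descFactorial k : ℝ) * ((a : ℝ) / π) ^ (k + 1))
          * (((a : ℝ) ^ (q - k) - (-(a : ℝ)) ^ (q - k)) * (I ^ (k + 1)).im) / 2)
      (imgLogBoxO S X a q dd) := by
  unfold imgLogBoxO
  refine mem_sumFIO fun k _ _ ↦ ?_
  have hm := mem_mulRatBox (mem_powIO hS hX.hAP (k + 1)) (wQO q k * alphaQO a q k / 2)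
  convert hm using 1
  push_cast; rw [wQ_castO, alphaQ_castO]; ring

/-- **Cosine-tag image coefficient box** (odd): `Σ_{k+1=dd} w_k (a/π)^{k+1} α'_k`. -/
def imgCosBoxO (S : ℕ) (X : ImgInputsO) (a : ℚ) (q dd : ℕ) : MI :=
  sumFIO S (q + 1) (fun k ↦ k + 1 = dd) (fun k ↦ mulRatBox (powIO S X.AP (k + 1)) (wQO q k * alphaQO a q k))

/-- **`imgCosBoxO ∋ P_C(q,dd)`** (verbatim, beta-reduced). -/
theorem mem_imgCosBoxO (hS : 0 < S) (hX : ImgInputsValidO S a q ν R X) (dd : ℕ) :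
    MI.mem S (∑ k ∈ (Finset.range (q + 1)).filter (fun k ↦ k + 1 = dd),
        ((-1 : ℝ) ^ k * (q.descFactorial k : ℝ) * ((a : ℝ) / π) ^ (k + 1))
          * (((a : ℝ) ^ (q - k) - (-(a : ℝ)) ^ (q - k)) * (I ^ (k + 1)).im))
      (imgCosBoxO S X a q dd) := by
  unfold imgCosBoxO
  refine mem_sumFIO fun k _ _ ↦ ?_
  have hm := mem_mulRatBox (mem_powIO hS hX.hAP (k + 1)) (wQO q k * alphaQO a q k)
  convert hm using 1
  push_cast; rw [wQ_castO, alphaQ_castO]; ring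

/-- **Sine-tag image coefficient box**: `Σ_{k+1=dd} w_k (a/π)^{k+1} β_k`. -/
def imgSinBoxO (S : ℕ) (X : ImgInputsO) (a : ℚ) (q dd : ℕ) : MI :=
  sumFIO S (q + 1) (fun k ↦ k + 1 = dd) (fun k ↦ mulRatBox (powIO S X.AP (k + 1)) (wQO q k * betaQO a q k))

/-- **`imgSinBoxO ∋ P_S(q,dd)`** (verbatim, beta-reduced). -/
theorem mem_imgSinBoxO (hS : 0 < S) (hX : ImgInputsValidO S a q ν R X) (dd : ℕ) :
    MI.mem S (∑ k ∈ (Finset.range (q + 1)).filter (fun k ↦ k + 1 = dd),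
        ((-1 : ℝ) ^ k * (q.descFactorial k : ℝ) * ((a : ℝ) / π) ^ (k + 1))
          * (-(((a : ℝ) ^ (q - k) + (-(a : ℝ)) ^ (q - k)) * (I ^ (k + 1)).re)))
      (imgSinBoxO S X a q dd) := by
  unfold imgSinBoxO
  refine mem_sumFIO fun k _ _ ↦ ?_
  have hm := mem_mulRatBox (mem_powIO hS hX.hAP (k + 1)) (wQO q k * betaQO a q k)
  convert hm using 1
  push_cast; rw [wQ_castO, betaQ_castO]; ring

end Boxes

end CinfCoeff

end Summit.RiemannHypothesis.RiemannHypothesis.Theorems.WeilFormatC
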